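import Summits.Schanuel.Schanuel.Theorems.RootDecomp1BTranscendencePackageFloor05

/-!
# `RootDecomp1BPeriodKernelFloor` — part 01 of 02 (`RootDecomp1BPeriodKernelFloor01`): §1 helpers, §2 the independence inputs (`algebraicIndependent_pi_expPi`, `linearIndependent_one_pi_expPi`, `ℓ₀_not_mem_span_one_pi`), §3 the period-true shear (`exists_phi_pi`, `φ₁`, `S₁`, `E₁`), §4 the true kernel and the period plane (`τ_eq`, `E₁_eq_one_iff`, `E₁_add_mul_pi`, `E₁_pi`, `E₁_expPi`, `E₁_expPi_ne_exp`, `not_continuous_E₁`)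

PORT in two parts (≤ 400 lines each, shared namespace `Summit.Schanuel.Schanuel.Theorems.RootDecomp1BPeriodKernelFloor`, part 02 importing part 01; `--supports stmt-Schanuel-24622`) of the decomp-schanuel lens-4 kernel file `HOME/decomp-schanuel-lens-4/g19/PeriodKernelFloor.lean` (gen 19). Overview of the whole port:

# PERIOD-KERNEL FLOOR — `KleinPolarSchanuel` (crux `stmt-Schanuel-24622`), `SchanuelRank 3` and the summit text are FALSE WITHOUT a property of `exp` beyond the PERIOD PACKAGE: the algebraic-point transcendence package (E1)–(E4) of `RootDecomp1BTranscendencePackageFloor05` PLUS the true kernel `2πiℤ`, `E = exp` on `ℚ̄ ⊕ ℚ̄π`, and Nesterenko's theorem verbatim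

Negative-side certificate in `_false_without_` form for the crux `KleinPolarSchanuel` of route
`Summits/Schanuel/Schanuel/Theses/RootDecomp1B.lean` (decomp-schanuel programme, lens «minimal
counterexample / extremal reduction», generation 19, 2026-08-30; `--supports stmt-Schanuel-24622`);
sequel to the TRANSCENDENCE PACKAGE FLOOR (`RootDecomp1BTranscendencePackageFloor01`–`05`). Nothing
here proves or refutes a route item.

The model `E₀` of part 05 has kernel generator `τ₀ = θ₀⁻¹(2πi)`, in general `≠ 2πi`, and says
nothing about `π`: its filing note records "NOT claimed: `τ = 2πi`; Nesterenko for `E₀`". A proof of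
the crux could therefore a priori leave the floor through the PERIOD CHANNEL — the true kernel
`2πiℤ`, the values of `exp` on the period plane `ℚ̄ ⊕ ℚ̄π` (Gelfond's constant `e^π = (-1)^{-i}`),
and Nesterenko's algebraic independence of `π, e^π, Γ(1/4)`. This file closes that gap. Granted the
tree fact `Literature.NumberTheory.Transcendental.nesterenko` (hypothesis `hN`; PROVED in the tree as
`nesterenko_holds` in `Literature.NumberTheory.Transcendental.PeriodsWave0NesterenkoProofs`, kept as a
hypothesis only because that module tower has no hub olean at the time of writing — the convention
of `RootDecomp1ArgumentCells`), there is an exponential `E₁` on `ℂ` with the whole transcendence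
package AND the period channel for which Klein-polar Schanuel FAILS at length `2` (`r = (π, e^π)`),
`SchanuelRank 3` FAILS at `(iπ, π, e^π)` and the summit text FAILS. Hence any proof of the crux must
use a property of `exp` outside (E1)–(E4) ∪ (P1)–(P3) below — in the vocabulary of the programme's
critic ledger (B-R13): Lindemann–Weierstrass, Hermite–Lindemann, Gelfond–Schneider, Baker, the
kernel, the period plane and Nesterenko AS BLACK BOXES are insufficient; the first property of `exp`
not shared by `E₁` is its value at the NON-PERIOD transcendental point `e^π`
(`E₁ (e^π) = 2 ≠ e^{e^π}`: continuity / order on `ℝ`, or Lindemann–Weierstrass one level up,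
«LW+1 / N+1»). Sorry-free, standard axioms; consumes the tree theorem `baker_holds` and the named
fact `nesterenko` (as a hypothesis); introduces no fact.

## Construction (namespace `Summit.Schanuel.Schanuel.Theorems.RootDecomp1BPeriodKernelFloor`)

`A = ℚ̄ ∩ ℝ`, `ℓ₀ = log 2`, `w₀ = 2^i` (part 04). By Nesterenko, `1, π, e^π` are `A`-linearly
independent (`linearIndependent_one_pi_expPi`: a linear relation is a degree-one algebraic one over
`A`, and `π, e^π` are algebraically independent over `A` by extension of scalars); by Baker at the
`ℚ`-free logarithms `log 2, iπ` of `2, -1`, `log 2 ∉ A + Aπ` (`ℓ₀_not_mem_span_one_pi`). Hence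
(`exists_phi_pi`) an `A`-linear `φ₁ : ℝ → A` with `φ₁ 1 = φ₁ π = 0`, `φ₁ (e^π) = 1`,
`φ₁ (log 2) ≠ 0`; the shear `S₁ = (φ₁, u = e^π, ℓ = log 2)` of part 02 gives the `ℚ̄`-linear
bijection `θ₁ = id + (φ₁∘Re + iφ₁∘Im)·(log 2 − e^π)` of `ℂ` and `E₁ = exp ∘ θ₁` (`S₁`, `E₁`). New:
`θ₁` FIXES `ℚ̄ ⊕ ℚ̄π` POINTWISE (`θ_add_mul_pi`), so `τ = θ₁⁻¹(2πi) = 2πi` (`τ_eq`):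
`ker E₁ = 2πiℤ = ker exp` (`E₁_eq_one_iff`, `E₁_eq_one_iff_exp_eq_one`), `E₁ = exp` on `ℚ̄ ⊕ ℚ̄π`
(`E₁_add_mul_pi`; `E₁ π = e^π`, `E₁ (iπ) = -1`), and NESTERENKO HOLDS VERBATIM for `E₁`
(`nesterenkoE_E₁`: `π, E₁ π, Γ(1/4)` algebraically independent). Still `E₁ (e^π) = 2`,
`E₁ (ie^π) = 2^i` (`E₁_expPi`, `E₁_expPi_mul_I`), `E₁ ≠ exp` (`E₁_expPi_ne_exp`), `E₁` is
discontinuous (`not_continuous_E₁`, `not_continuous_E₁_real`).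

## Verdicts

* the package: `transcendencePackage_E₁` ((E1) `IsInvolutiveExp`, (E2) `AgreesOnQbar`, (E3)
  Lindemann–Weierstrass, Hermite–Lindemann, Gelfond–Schneider, Baker verbatim, (E4) rank one — as for
  `E₀`); `periodPackage_E₁` adds (P1) `TrueKernel`, (P2) `AgreesOnPeriodPlane`, (P3) `NesterenkoE`;
  `periodPackage_exp` (the genuine exponential has it too).
* `kleinPolar_pi_cell_E₁`: the LENGTH-ONE Klein-polar cell at `r = (π)` HOLDS for `E₁`
  (`trdeg ℚ(π, iπ, e^π, -1) = 2`, Nesterenko) — the failure below is a genuine storey-two phenomenon.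
* `not_kleinPolarE_E₁`: **X(2) FAILS** at the `ℚ`-free real pair `r = (π, e^π)`: the eight
  generators `π, e^π, iπ, ie^π, E₁ π = e^π, E₁ e^π = 2, E₁(iπ) = -1, E₁(ie^π) = 2^i` are algebraic
  over `K₁ = ℚ(π, e^π, 2^i)`, so `trdeg ≤ 3 < 4`.
* `not_schanuelRankE_E₁_three`: **S(3) FAILS** at the `ℚ`-free, `conj`-stable triple `(iπ, π, e^π)`
  (`trdeg ℚ(iπ, π, e^π, -1, e^π, 2) ≤ 2 < 3`); `not_schanuelE_E₁`.
* headlines: `kleinPolarSchanuel_false_without_channel_beyond_periods`,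
  `schanuelRank_three_false_without_channel_beyond_periods`,
  `schanuel_false_without_channel_beyond_periods` (`¬ ∀ E, PeriodPackage E → …`),
  `periodKernelFloor` (existence form), `periodPackage_exp_dictionary` (at `E = exp` the three
  statements ARE the crux, the tree's `SchanuelRank 3` and the summit `Schanuel`, by `Iff.rfl`).

(The verdicts, the period package, the headline statements and the «rank cost / not claimed» list are in part 02.)

PORT VARIANT (lens-4 g20, mechanical): the `variable (hN : nesterenko)` section variables of the
g19 port are replaced by an explicit `(hN : nesterenko)` binder on each declaration that mentions
it (statements and proof terms unchanged; binder order unchanged, `hN` first).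
-/

noncomputable section

open Complex

namespace Summit.Schanuel.Schanuel.Theorems.RootDecomp1BPeriodKernelFloor

set_option linter.dupNamespace false

open Summit.Schanuel.Schanuel.Theorems.RootDecomp1BTranscendencePackageFloor
open Literature.NumberTheory.Transcendental (nesterenko baker_holds SchanuelRank)

/-! ## §1 Helpers -/

/-- An element of an intermediate field `K` is algebraic over `K`. [folklore] -/
private theorem isAlgebraic_of_mem {K : IntermediateField ℚ ℂ} {x : ℂ} (hx : x ∈ K) :
    IsAlgebraic K x :=
  isAlgebraic_algebraMap (⟨x, hx⟩ : K)

/-- `2` is algebraic. [folklore] -/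
private theorem two_isAlgebraic : IsAlgebraic ℚ (2 : ℂ) := by
  have h : IsAlgebraic ℚ ((2 : ℕ) : ℂ) := isAlgebraic_nat 2
  simpa using h

/-- `-1` is algebraic. [folklore] -/
private theorem neg_one_isAlgebraic : IsAlgebraic ℚ (-1 : ℂ) := by
  have h : IsAlgebraic ℚ ((-1 : ℤ) : ℂ) := isAlgebraic_int (-1)
  simpa using h

/-- `i` is algebraic. [folklore] -/
private theorem I_isAlgebraic : IsAlgebraic ℚ I := mem_Qb_iff.mp I_mem_Qb

/-- `2 ∈ ℚ̄`. [folklore] -/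
private theorem two_mem_Qb : (2 : ℂ) ∈ Qb := mem_Qb_iff.mpr two_isAlgebraic

/-! ## §2 The independence inputs: Nesterenko (hypothesis `nesterenko`, discharged in the tree by
`nesterenko_holds`) and Baker (tree theorem `baker_holds`) -/

/-- From Nesterenko's theorem: `π, e^π` are algebraically independent over `ℚ`.
[cite: Nesterenko1996SbMath, Theorem 1 and its corollaries] -/
theorem algebraicIndependent_pi_expPi (hN : nesterenko) :
    AlgebraicIndependent ℚ ![Real.pi, Real.exp Real.pi] := by
  have hN' : AlgebraicIndependent ℚ ![Real.pi, Real.exp Real.pi, Real.Gamma (1 / 4)] := hN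
  have h := hN'.comp (Fin.castSucc : Fin 2 → Fin 3) (Fin.castSucc_injective _)
  have e : (![Real.pi, Real.exp Real.pi, Real.Gamma (1 / 4)] ∘ (Fin.castSucc : Fin 2 → Fin 3)) =
      ![Real.pi, Real.exp Real.pi] := by
    funext i; fin_cases i <;> simp
  rw [e] at h
  exact h

/-- … hence over `A = ℚ̄ ∩ ℝ` (extension of scalars along the algebraic extension `ℚ ⊆ A`).
[cite: Nesterenko1996SbMath, Theorem 1 and its corollaries] -/
theorem algebraicIndependent_pi_expPi_A (hN : nesterenko) :
    AlgebraicIndependent A ![Real.pi, Real.exp Real.pi] := by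
  haveI : Algebra.IsAlgebraic ℚ A := algebraicClosure.isAlgebraic ℚ ℝ
  exact (algebraicIndependent_pi_expPi hN).extendScalars _

/-- … and as complex numbers: `π, e^π ∈ ℂ` are algebraically independent over `ℚ`.
[cite: Nesterenko1996SbMath, Theorem 1 and its corollaries] -/
theorem algebraicIndependent_pi_expPi_complex (hN : nesterenko) :
    AlgebraicIndependent ℚ ![(Real.pi : ℂ), cexp Real.pi] := by
  have h := (algebraicIndependent_pi_expPi hN).map'
    (f := (AlgHom.restrictScalars ℚ Complex.ofRealAm : ℝ →ₐ[ℚ] ℂ)) Complex.ofReal_injective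
  have e : ((AlgHom.restrictScalars ℚ Complex.ofRealAm : ℝ →ₐ[ℚ] ℂ) : ℝ → ℂ) ∘
      ![Real.pi, Real.exp Real.pi] = ![(Real.pi : ℂ), cexp Real.pi] := by
    funext i; fin_cases i <;> simp [Complex.ofReal_exp]
  rw [e] at h
  exact h

/-- `π, e^π` are `ℚ`-linearly independent reals. [cite: Nesterenko1996SbMath, Theorem 1 and its corollaries] -/
theorem linearIndependent_pi_expPi (hN : nesterenko) :
    LinearIndependent ℚ ![Real.pi, Real.exp Real.pi] :=
  (algebraicIndependent_pi_expPi hN).linearIndependent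

/-- `1, π, e^π` are linearly independent over `A = ℚ̄ ∩ ℝ` (a linear relation would be a degree-one
algebraic relation over `A`). [cite: Nesterenko1996SbMath, Theorem 1 and its corollaries] -/
theorem linearIndependent_one_pi_expPi (hN : nesterenko) :
    LinearIndependent A ![(1 : ℝ), Real.pi, Real.exp Real.pi] := by
  classical
  have hA := algebraicIndependent_pi_expPi_A hN
  show LinearIndependent A (Fin.cons (1 : ℝ) ![Real.pi, Real.exp Real.pi])
  refine linearIndependent_finCons.mpr ⟨hA.linearIndependent, ?_⟩
  intro hmem
  rw [Submodule.mem_span_range_iff_exists_fun] at hmem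
  obtain ⟨c, hc⟩ := hmem
  let P : MvPolynomial (Fin 2) A := ∑ i, MvPolynomial.C (c i) * MvPolynomial.X i - 1
  have hP : MvPolynomial.aeval ![Real.pi, Real.exp Real.pi] P = 0 := by
    simp only [P, map_sub, map_sum, map_mul, MvPolynomial.aeval_C, MvPolynomial.aeval_X, map_one]
    rw [sub_eq_zero, ← hc]
    refine Finset.sum_congr rfl fun i _ => ?_
    rw [Algebra.smul_def]
  have hP0 : P = 0 := hA (by rw [hP, map_zero])
  have h2 := congrArg MvPolynomial.constantCoeff hP0
  simp only [P, map_sub, map_sum, map_mul, MvPolynomial.constantCoeff_C,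
    MvPolynomial.constantCoeff_X, mul_zero, Finset.sum_const_zero, map_one, map_zero,
    zero_sub, neg_eq_zero, one_ne_zero] at h2

/-- The pair of logarithms `(log 2, iπ)` is `ℚ`-free. [folklore] -/
theorem linearIndependent_ℓ₀_piI : LinearIndependent ℚ ![(ℓ₀ : ℂ), (Real.pi : ℂ) * I] := by
  rw [LinearIndependent.pair_iff]
  intro s t h
  rw [Rat.smul_def, Rat.smul_def] at h
  have hre := congrArg Complex.re h
  have him := congrArg Complex.im h
  simp at hre him
  rcases hre with hre | hre
  · exact ⟨hre, him⟩
  · exact absurd hre ℓ₀_pos.ne'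

/-- BAKER: `log 2 ∉ A + A·π` — from the `ℚ̄`-linear independence of `1, log 2, iπ` (Baker's
theorem for the `ℚ`-free logarithms `log 2, iπ` of the algebraic numbers `2, -1`).
[cite: Baker1966, 68] -/
theorem ℓ₀_not_mem_span_one_pi : ℓ₀ ∉ Submodule.span A (Set.range ![(1 : ℝ), Real.pi]) := by
  intro hmem
  rw [Submodule.mem_span_range_iff_exists_fun] at hmem
  obtain ⟨c, hc⟩ := hmem
  rw [Fin.sum_univ_two] at hc
  simp only [Matrix.cons_val_zero, Matrix.cons_val_one] at hc
  have hc' : ((c 0 : ℝ) : ℂ) + ((c 1 : ℝ) : ℂ) * (Real.pi : ℂ) = (ℓ₀ : ℂ) := by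
    have h1 : (c 0 : ℝ) + (c 1 : ℝ) * Real.pi = ℓ₀ := by
      have h2 := hc
      simp only [Algebra.smul_def, mul_one] at h2
      exact h2
    exact_mod_cast congrArg ((↑) : ℝ → ℂ) h1
  let l : Fin 2 → ℂ := ![(ℓ₀ : ℂ), (Real.pi : ℂ) * I]
  have halg : ∀ i, IsAlgebraic ℚ (cexp (l i)) := by
    intro i
    fin_cases i
    · simpa [l, exp_ℓ₀] using two_isAlgebraic
    · simpa [l, Complex.exp_pi_mul_I] using neg_one_isAlgebraic
  have hB := baker_holds l halg linearIndependent_ℓ₀_piI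
  have h0 : ((c 0 : ℝ) : ℂ) ∈ Qb := mem_A_iff_coe_mem_Qb.mp (c 0).2
  have h1 : -((c 1 : ℝ) : ℂ) * I ∈ Qb :=
    mul_mem (neg_mem (mem_A_iff_coe_mem_Qb.mp (c 1).2)) I_mem_Qb
  let g : Option (Fin 2) → Qb := fun o => o.elim ⟨_, h0⟩ ![(-1 : Qb), ⟨_, h1⟩]
  have hsum : ∑ o, g o • (o.elim (1 : ℂ) l) = 0 := by
    rw [Fintype.sum_option, Fin.sum_univ_two]
    simp only [g, l, Option.elim, Matrix.cons_val_zero, Matrix.cons_val_one]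
    rw [IntermediateField.smul_def, IntermediateField.smul_def, IntermediateField.smul_def]
    simp only [IntermediateField.coe_neg, IntermediateField.coe_one]
    rw [← hc']
    linear_combination (-((c 1 : ℝ) : ℂ) * (Real.pi : ℂ)) * Complex.I_sq
  have key := Fintype.linearIndependent_iff.mp hB g hsum (some 0)
  simp [g] at key

/-! ## §3 The period-true shear: `φ 1 = 0`, `φ π = 0`, `φ (e^π) = 1`, `φ (log 2) ≠ 0` -/

/-- The shear functional of the period-true model exists: an `A`-linear `φ : ℝ → A` with
`φ 1 = 0`, `φ (e^π) = 1`, `φ (log 2) ≠ 0` and `φ π = 0` (Nesterenko supplies the `A`-independence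
of `1, π, e^π`; Baker the non-degeneracy in the dependent case). [folklore] -/
theorem exists_phi_pi (hN : nesterenko) :
    ∃ φ : ℝ →ₗ[A] A, φ 1 = 0 ∧ φ (Real.exp Real.pi) = 1 ∧ φ ℓ₀ ≠ 0 ∧ φ Real.pi = 0 := by
  have hli3 := linearIndependent_one_pi_expPi hN
  by_cases hmem : ℓ₀ ∈ Submodule.span A (Set.range ![(1 : ℝ), Real.pi, Real.exp Real.pi])
  · obtain ⟨φ, hφ⟩ := exists_functional hli3 ![0, 0, 1]
    have h0 : φ 1 = 0 := by simpa using hφ 0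
    have hπ : φ Real.pi = 0 := by simpa using hφ 1
    have h1 : φ (Real.exp Real.pi) = 1 := by simpa using hφ 2
    refine ⟨φ, h0, h1, ?_, hπ⟩
    rw [Submodule.mem_span_range_iff_exists_fun] at hmem
    obtain ⟨cf, hcf⟩ := hmem
    rw [Fin.sum_univ_three] at hcf
    simp only [Matrix.cons_val_zero, Matrix.cons_val_one, Matrix.cons_val] at hcf
    have hφℓ : φ ℓ₀ = cf 2 := by
      rw [← hcf, map_add, map_add, map_smul, map_smul, map_smul, h0, hπ, h1, smul_zero, smul_zero,
        zero_add, zero_add, smul_eq_mul, mul_one]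
    intro hzero
    rw [hφℓ] at hzero
    apply ℓ₀_not_mem_span_one_pi
    rw [Submodule.mem_span_range_iff_exists_fun]
    refine ⟨![cf 0, cf 1], ?_⟩
    rw [Fin.sum_univ_two]
    simp only [Matrix.cons_val_zero, Matrix.cons_val_one]
    rw [← hcf, hzero, zero_smul, add_zero]
  · have hli : LinearIndependent A ![ℓ₀, (1 : ℝ), Real.pi, Real.exp Real.pi] := by
      show LinearIndependent A (Fin.cons ℓ₀ ![(1 : ℝ), Real.pi, Real.exp Real.pi])
      exact linearIndependent_finCons.mpr ⟨hli3, hmem⟩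
    obtain ⟨φ, hφ⟩ := exists_functional hli ![1, 0, 0, 1]
    refine ⟨φ, by simpa using hφ 1, by simpa using hφ 3, ?_, by simpa using hφ 2⟩
    have : φ ℓ₀ = 1 := by simpa using hφ 0
    rw [this]
    exact one_ne_zero

/-- The chosen functional of the period-true model. [folklore] -/
def φ₁ (hN : nesterenko) : ℝ →ₗ[A] A := Classical.choose (exists_phi_pi hN)

/-- `φ₁ 1 = 0`, `φ₁ (e^π) = 1`, `φ₁ (log 2) ≠ 0`, `φ₁ π = 0`. [folklore] -/
theorem φ₁_spec (hN : nesterenko) :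
    φ₁ hN 1 = 0 ∧ φ₁ hN (Real.exp Real.pi) = 1 ∧ φ₁ hN ℓ₀ ≠ 0 ∧ φ₁ hN Real.pi = 0 :=
  Classical.choose_spec (exists_phi_pi hN)

/-- The PERIOD-TRUE SHEAR `(φ₁, u = e^π, ℓ = log 2)`: `θ₁ = id + (φ₁∘Re + iφ₁∘Im)·(log 2 − e^π)`
moves `e^π ↦ log 2` and fixes `ℚ̄ ⊕ ℚ̄π` pointwise. [folklore] -/
def S₁ (hN : nesterenko) : Shear :=
  ⟨φ₁ hN, Real.exp Real.pi, ℓ₀, (φ₁_spec hN).1, (φ₁_spec hN).2.1, (φ₁_spec hN).2.2.1⟩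

/-- The PERIOD-TRUE SHEARED EXPONENTIAL `E₁ = exp ∘ θ₁`. [folklore] -/
def E₁ (hN : nesterenko) : ℂ → ℂ := (S₁ hN).E

section Model


/-- `E₁` unfolds to the exponential of the shear `S₁`. [folklore] -/
theorem E₁_def (hN : nesterenko) : E₁ hN = (S₁ hN).E := rfl

/-- The moved point of `S₁` is `e^π`. [folklore] -/
theorem S₁_u (hN : nesterenko) : (S₁ hN).u = Real.exp Real.pi := rfl

/-- Its image under `θ₁` is `log 2`. [folklore] -/
theorem S₁_ℓ (hN : nesterenko) : (S₁ hN).ℓ = ℓ₀ := rfl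

/-- `φ₁` kills `π`. [folklore] -/
theorem φR_pi (hN : nesterenko) : (S₁ hN).φR Real.pi = 0 := by
  have h := (φ₁_spec hN).2.2.2
  show ((φ₁ hN Real.pi : A) : ℝ) = 0
  rw [h]
  rfl

/-! ## §4 The kernel is the TRUE one: `θ₁` fixes `ℚ̄ ⊕ ℚ̄·π`, so `τ = 2πi` -/

/-- `θ₁ π = π`. [folklore] -/
theorem θ_pi (hN : nesterenko) : (S₁ hN).θ (Real.pi : ℂ) = Real.pi := by
  rw [Shear.θ_ofReal, φR_pi, zero_mul, add_zero]

/-- `θ₁ (q·π) = q·π` for algebraic `q`. [folklore] -/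
theorem θ_mul_pi (hN : nesterenko) {q : ℂ} (hq : q ∈ Qb) : (S₁ hN).θ (q * Real.pi) = q * Real.pi := by
  rw [Shear.θ_mul_of_mem _ hq, θ_pi]

/-- `θ₁` fixes `ℚ̄ ⊕ ℚ̄·π` pointwise. [folklore] -/
theorem θ_add_mul_pi (hN : nesterenko) {p q : ℂ} (hp : p ∈ Qb) (hq : q ∈ Qb) :
    (S₁ hN).θ (p + q * Real.pi) = p + q * Real.pi := by
  rw [Shear.θ_add, Shear.θ_of_mem _ hp, θ_mul_pi hN hq]

/-- `θ₁ (2πi) = 2πi`. [folklore] -/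
theorem θ_two_pi_I (hN : nesterenko) : (S₁ hN).θ (2 * Real.pi * I) = 2 * Real.pi * I := by
  have h : (2 * Real.pi * I : ℂ) = (2 * I) * Real.pi := by ring
  rw [h, θ_mul_pi hN (mul_mem two_mem_Qb I_mem_Qb)]

/-- **The kernel generator of `E₁` is `2πi` itself.** [folklore] -/
theorem τ_eq (hN : nesterenko) : (S₁ hN).τ = 2 * Real.pi * I := by
  apply (S₁ hN).θ_injective
  rw [Shear.θ_τ, θ_two_pi_I]

/-- **TRUE KERNEL**: `E₁ z = 1 ↔ z ∈ 2πiℤ` — the kernel of `exp` (`Complex.exp_eq_one_iff`).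
[folklore] -/
theorem E₁_eq_one_iff (hN : nesterenko) (z : ℂ) : E₁ hN z = 1 ↔ ∃ n : ℤ, z = n * (2 * Real.pi * I) := by
  rw [E₁_def, Shear.E_eq_one_iff, τ_eq]

/-- `ker E₁ = ker exp`. [folklore] -/
theorem E₁_eq_one_iff_exp_eq_one (hN : nesterenko) (z : ℂ) : E₁ hN z = 1 ↔ cexp z = 1 := by
  rw [E₁_eq_one_iff, Complex.exp_eq_one_iff]

/-- **`E₁ = exp` on the period plane `ℚ̄ ⊕ ℚ̄·π`** (in particular on `ℚ̄ ⊕ ℚ̄·2πi`). [folklore] -/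
theorem E₁_add_mul_pi (hN : nesterenko) {p q : ℂ} (hp : IsAlgebraic ℚ p) (hq : IsAlgebraic ℚ q) :
    E₁ hN (p + q * Real.pi) = cexp (p + q * Real.pi) := by
  show cexp ((S₁ hN).θ (p + q * Real.pi)) = _
  rw [θ_add_mul_pi hN (mem_Qb_iff.mpr hp) (mem_Qb_iff.mpr hq)]

/-- `E₁ π = e^π`. [folklore] -/
theorem E₁_pi (hN : nesterenko) : E₁ hN Real.pi = cexp Real.pi := by
  show cexp ((S₁ hN).θ Real.pi) = _
  rw [θ_pi]

/-- `E₁ (iπ) = -1`. [folklore] -/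
theorem E₁_pi_mul_I (hN : nesterenko) : E₁ hN ((Real.pi : ℂ) * I) = -1 := by
  show cexp ((S₁ hN).θ ((Real.pi : ℂ) * I)) = _
  rw [show ((Real.pi : ℂ) * I) = I * Real.pi by ring, θ_mul_pi hN I_mem_Qb,
    show (I * Real.pi : ℂ) = Real.pi * I by ring, Complex.exp_pi_mul_I]

/-- `E₁ (e^π) = 2` (the shear moves `e^π` to `log 2`). [folklore] -/
theorem E₁_expPi (hN : nesterenko) : E₁ hN ((Real.exp Real.pi : ℝ) : ℂ) = 2 := by
  show cexp ((S₁ hN).θ ((S₁ hN).u : ℂ)) = 2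
  rw [Shear.θ_u]
  exact exp_ℓ₀

/-- `E₁ (i e^π) = 2^i = w₀`. [folklore] -/
theorem E₁_expPi_mul_I (hN : nesterenko) : E₁ hN (((Real.exp Real.pi : ℝ) : ℂ) * I) = w₀ := by
  show cexp ((S₁ hN).θ (((S₁ hN).u : ℂ) * I)) = w₀
  rw [Shear.θ_u_mul_I]
  rfl

/-- `E₁ (e^π) = 2`, argument written as `cexp π`. [folklore] -/
theorem E₁_cexpPi (hN : nesterenko) : E₁ hN (cexp Real.pi) = 2 := by
  rw [← Complex.ofReal_exp]; exact E₁_expPi hN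

/-- `E₁ (i e^π) = w₀`, argument written with `cexp π`. [folklore] -/
theorem E₁_cexpPi_mul_I (hN : nesterenko) : E₁ hN (cexp Real.pi * I) = w₀ := by
  rw [← Complex.ofReal_exp]; exact E₁_expPi_mul_I hN

/-- `E₁ (e^π) = 2 ≠ e^{e^π} = exp (e^π)`: `E₁ ≠ exp` already at the Gelfond constant. [folklore] -/
theorem E₁_expPi_ne_exp (hN : nesterenko) : E₁ hN ((Real.exp Real.pi : ℝ) : ℂ) ≠ cexp ((Real.exp Real.pi : ℝ) : ℂ) := by
  rw [E₁_expPi, ← Complex.ofReal_exp]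
  intro h
  have h' : (2 : ℝ) = Real.exp (Real.exp Real.pi) := by exact_mod_cast h
  have h1 := Real.add_one_le_exp Real.pi
  have h2 := Real.add_one_le_exp (Real.exp Real.pi)
  have h3 := Real.pi_gt_three
  linarith

/-- The shear parameter `d = log 2 − e^π ≠ 0`. [folklore] -/
theorem S₁_d_ne_zero (hN : nesterenko) : (S₁ hN).d ≠ 0 := by
  show ℓ₀ - Real.exp Real.pi ≠ 0
  have h1 := Real.add_one_le_exp Real.pi
  have h2 := Real.pi_gt_three
  have h3 := ℓ₀_lt
  intro h
  norm_num at h3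
  linarith

/-- `E₁` is discontinuous on the real axis. [folklore] -/
theorem not_continuous_E₁_real (hN : nesterenko) : ¬ Continuous fun x : ℝ => E₁ hN x :=
  (S₁ hN).not_continuous_E_ofReal (S₁_d_ne_zero hN)

/-- `E₁` is discontinuous. [folklore] -/
theorem not_continuous_E₁ (hN : nesterenko) : ¬ Continuous (E₁ hN) := (S₁ hN).not_continuous_E (S₁_d_ne_zero hN)

end Model

end Summit.Schanuel.Schanuel.Theorems.RootDecomp1BPeriodKernelFloor

end
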